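import Summits.HodgeConjecture.HodgeConjecture.Theorems.F0AlbCmS1RealisationHodge
import Literature.AlgebraicGeometry.HodgeTheory.HodgeTypeConjugateEmbeddingHolds
import Summits.HodgeConjecture.HodgeConjecture.Theorems.F0AlbCmS1bSignedExclusionNec   -- T2′: the S1b exclusion on the NECESSITY letters E3nec₂
import Summits.HodgeConjecture.HodgeConjecture.Theorems.HLiu418E3Necessity   -- T1′: E3nec-antihol ⇐ E3nec-hol
import Summits.HodgeConjecture.CorCM.HypLiu418.A3Liu418GSInstance
import Summits.HodgeConjecture.CorCM.HypLiu418.A3Liu418GSThmD6OneCurve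
import Literature.NumberTheory.Automorphic.UnitaryCurveCotangentSpectralProjectionConj
import Literature.NumberTheory.Automorphic.Liu2021.AppendixC.EtaleBettiComparison
import Literature.NumberTheory.Automorphic.Liu2021.AppendixC.BettiPinningHodgeSplit
import Literature.NumberTheory.Automorphic.UnitaryGroupLevelTransport
import Literature.NumberTheory.Automorphic.UnitaryGroupArchFactor
import Literature.NumberTheory.Automorphic.UnitaryGroupArchEmbedding
import Literature.AlgebraicGeometry.ShimuraVarieties.UnitaryBallQuotientDatum
import Literature.NumberTheory.Automorphic.UnitaryCurveCohCotangentForms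
import Literature.NumberTheory.Automorphic.UnitaryCurveConeFrameOfSig
import Mathlib.RepresentationTheory.Intertwining
import Mathlib.RepresentationTheory.Invariants
import HarnessLib

/-!
# Crux `HLiu418`, line `F0_AlbCm` — ROAD (A) twin of the parent's `stub_S1b_hodge : S1bHodgeShape` ON THE NECESSITY LETTERS E3nec₂
# (★ `Rogawski1990/CurveThetaHodgeTypeNecessity`, [Liu2021, Rem. D.5] «only if» half): `stub_S1b_hodge_holds_nec (hE3hol) (hE3antihol) (hTPhol)` and
# `stub_S1b_hodge_holds_nec_of_hol (hE3hol) (hTPhol)` — twin of ★ `Theorems/F0AlbCmS1bHodgeHolds.lean` (F0P5-p04 (g2), p799804)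

Floor-0 programme P5 (Alb-CM), seat F0P5-p02 (g4) («T4′a» of the P5 desk's word #11, 2026-08-31); crux item stmt-HodgeConjecture-24832 (`HCCMUnconditional.HLiu418`).
THEOREMS ONLY (no `def`, no named fact, no instance, no `sorry`); named-fact inputs are HYPOTHESES BY THEIR LITERATURE NAMES.  HC_CM is proved only modulo the 7
printed citations until rung 0 closes.  = ★ `F0AlbCmS1bHodgeHolds.lean` VERBATIM except: header, the two E3 hypothesis TYPES weakened from the signed biconditionals
★ `curveThetaHodgeTypeSigned_hol ∕ _antihol` to the necessity letters ★ `curveThetaHodgeTypeNecessity_hol ∕ _antihol` («occurrence ∧ admissible ⇒ sign of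
`e♮`»), and the one call ★ `F0AlbCmS1bSignedExclusion.stub_S1b_signedExclusion_of_letters` ↦ ★ T2′ `F0AlbCmS1bSignedExclusionNec.stub_S1b_signedExclusion_of_nec_letters`
(census F0P5-p02 (g4) `F0/P5/p02/CENSUS-E3-direction.v1`, desk word #11: the chain consumes only those directions); plus `stub_S1b_hodge_holds_nec_of_hol` with the
antihol necessity DERIVED by ★ T1′ `E3Necessity.curveThetaHodgeTypeNecessity_antihol_of_hol` (p04 (g3)'s conjugation road).  CONCLUSION = the body of the parent's
`S1bHodgeShape` TOKEN FOR TOKEN, so the parent may read (ED. 10, desk word #11) `stub_S1b_facts : Rogawski1990.curveThetaHodgeTypeNecessity_hol` with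
`stub_S1b_hodge := F0AlbCmS1bHodgeHoldsNec.stub_S1b_hodge_holds_nec stub_S1b_facts (E3Necessity.curveThetaHodgeTypeNecessity_antihol_of_hol stub_S1b_facts) F0P5TP2Holds.holCotFormSpectralProjection₂_holds`.

PROOF, ORIENTATION and inputs: as in the ★ twin (cone frame ★ `nonempty_coneFrame_of_sig`; typed realisation ★ `F0AlbCmS1RealisationHodge.stub_S1_realisationHodge_of_A1` at ★
`ConjEmbedding.isOfHodgeType_conj_iff_holds`; the signed exclusion now ★ T2′; the four sub-cases `e♮ = ι₁ ∕ ῑ₁` × `ι₁ ∈ ∕ ∉ Φ_μ` closed by ★ `BettiPinning.isOfHodgeType_of_mem_isotypic`;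
`hTPantihol` derived in-file by ★ `antiholCotFormSpectralProjection₂_of_hol`; sign table `F0/P5/p04/SIGN-TABLE-RemD5.md`, `e♮ := (cmPlace F ι₁).1.embedding`).

## References
* [Liu2021] Y. Liu, *Fourier–Jacobi cycles and arithmetic relative trace formula*, Camb. J. Math. 9 (2021): Rem. D.5 p. 131; Prop. D.4 (1) p. 130;
  Lem. D.1 (4); Lem. D.2 (3) p. 127; §D.2 (D.1) p. 128; proof of Thm. D.6 (1) p. 140 (l. 5625–5631).
* [Rogawski1990] J. Rogawski, *Automorphic representations of unitary groups in three variables*, Ann. of Math. Stud. 123 (1990), §11.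
* [HarrisKudlaSweet1996] M. Harris, S. Kudla, W. J. Sweet, J. AMS 9 (1996), Thm. 6.1.
* [Deligne1979Valeurs] P. Deligne, PSPM 33.2 (1979), 0.2.5 p. 315.  [BorelWallach2000] VII 3.2.  [BorelJacquet1979] PSPM 33.1 (1979), §4.6.
* [VoisinHodgeI2002] C. Voisin, *Hodge Theory and Complex Algebraic Geometry I* (2002), §6.1.3 Cor. 6.14, §7.3.2.
-/

set_option autoImplicit false
set_option linter.dupNamespace false  -- `Summit.HodgeConjecture.HodgeConjecture.…` BY DESIGN (D-0017)

noncomputable section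

namespace Summit.HodgeConjecture.HodgeConjecture.Cruxes.HLiu418.F0AlbCmS1bHodgeHoldsNec

open scoped TensorProduct Matrix NumberField Kronecker ComplexOrder
open NumberField NumberField.InfinitePlace IsDedekindDomain
open Summit.HodgeConjecture.CorCM.Model Summit.HodgeConjecture.CorCM.Model.HComp Summit.HodgeConjecture.CorCM.HComp
open Literature.AlgebraicGeometry.Motives (CMType AbelianVariety)
open Literature.AlgebraicGeometry.ShimuraVarieties Literature.AlgebraicGeometry.ShimuraVarieties.UnitaryCanonicalModel
open Literature.NumberTheory.Automorphic Literature.NumberTheory.Automorphic.UnitaryGroup Literature.NumberTheory.Automorphic.UnitaryCurveForms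
open Literature.NumberTheory.Automorphic.IdeleClassGroup Literature.NumberTheory.Automorphic.Liu2021 Literature.NumberTheory.Automorphic.Liu2021.AppendixC
open Literature.NumberTheory.GaloisRepresentations Literature.RepresentationTheory.Liu2021 Literature.RepresentationTheory.HarrisKudlaSweet1996
open Literature.AlgebraicGeometry.Liu2021 (IsAdmissibleElement)
open Literature.NumberTheory.Weil1964 Literature.NumberTheory.GelbartRogawski1991 Literature.NumberTheory.GelbartRogawski1991.UnitaryDualPair Literature.NumberTheory.GelbartRogawski1991.UnitaryDualPair.WeilCoinv
open Literature.NumberTheory.GelbartRogawski1991.UnitaryDualPair.LocalSplitting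
open Literature.NumberTheory.Automorphic.Liu2021.Def411WeilCarriersDoubling
open Literature.NumberTheory.Automorphic.Liu2021.Def411WeilCarriers (TW JW JW_eq isSymm_TW isUnit_det_TW Rep Eps epsOf Chi rhoVAtLine)
open Summit.HodgeConjecture.CorCM (CMField)
open Summit.HodgeConjecture.CorCM.Lines.A3Liu418

set_option maxHeartbeats 400000 in  -- the `ω⋆_lab` term is elaborated four times (closer × two clauses + `noψ` × two); measured > 200 k in the line file
/-- **`stub_S1b_hodge_holds` — the parent's `stub_S1b_hodge : S1bHodgeShape` MODULO EXACTLY THE NAMED FACTS E3hol ∕ E3antihol ∕ TPhol.**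
S1 clause (2) of [Liu2021, Prop. D.4 (1) ∕ Rem. D.5 with Lem. D.2 (3)] in the BETTI ∕ HODGE currency of the GS tower's own levels: a level class `y` whose
pinned image lies in the `ω⋆_lab`-isotypic part is of Hodge type `(1,0)` if `ι₁ ∈ Φ_μ` and `(0,1)` otherwise.  Conclusion = the body of `S1bHodgeShape`
(parent ED. 3 :160–:202) TOKEN FOR TOKEN; proof = the sub-sub-line's junction over the ★ closers (module docstring).
[cite: Liu2021, Rem. D.5 p. 131; proof of Thm. D.6 (1) p. 140 (l. 5625–5631); §D.2 (D.1) p. 128] [cite: Rogawski1990, §11]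
[cite: Deligne1979Valeurs, 0.2.5 (p. 315)] [cite: BorelWallach2000, VII 3.2] [cite: BorelJacquet1979, §4.6] -/
theorem stub_S1b_hodge_holds_nec
    (hE3hol : Literature.NumberTheory.Rogawski1990.curveThetaHodgeTypeNecessity_hol)
    (hE3antihol : Literature.NumberTheory.Rogawski1990.curveThetaHodgeTypeNecessity_antihol)
    (hTPhol : Literature.NumberTheory.Automorphic.UnitaryCurveForms.holCotFormSpectralProjection₂) :
    ∀ (F : CMField) [IsGalois ℚ F] (ι₁ : F →+* ℂ)
      (μ : Literature.NumberTheory.Automorphic.IdeleClassGroup (F : Type) →ₜ* Circle)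
      (hμ : IdeleClassGroup.IsConjugateSymplectic (F : Type) μ)
      (_hw : IdeleClassGroup.HasWeight (F : Type) μ 1)
      (Jstar : Matrix (Fin 2) (Fin 2) (F : Type)) (t : (F : Type)) (ht : t ≠ 0) (_hτt : 0 < (ι₁ t).re) (_hτt' : (ι₁ t).im = 0)
      (gstar : GL (Fin 2) (F : Type))
      (dJ : Fin 2 → (F : Type)) (hdJ : ∀ i, IsCMField.complexConj (F : Type) (dJ i) = dJ i) (hdJ0 : ∀ i, dJ i ≠ 0)
      (hg : formCongr ((IsCMField.complexConj (F : Type) : (F : Type) ≃ₐ[↥(maximalRealSubfield (F : Type))] (F : Type)) :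
          (F : Type) →+* (F : Type)) gstar (t • Jstar) = Matrix.diagonal dJ)
      (_hsig : (∃ Tstar : GL (Fin 2) ℂ,
          formCongr (starRingEnd ℂ) Tstar ((Matrix.diagonal dJ).map ι₁) = Matrix.diagonal ![(1 : ℂ), -1]) ∧
        ∀ τ' : (F : Type) →+* ℂ, InfinitePlace.mk τ' ≠ InfinitePlace.mk ι₁ → ((Matrix.diagonal dJ).map τ').PosDef)
      (K₀ : C5.OpenCompactSubgroup ↥(finAdelic ↥(maximalRealSubfield (F : Type)) (F : Type) (IsCMField.complexConj (F : Type)) 2 Jstar))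
      (S : RecordSystemGS (F : Type) Jstar ι₁ K₀) (hU7ₛ : S.HeckeTranslateDefinedOver)
      (h4 : 4 ≤ Module.finrank ℚ (F : Type)) (isoₛ : ℕ → Prop)
      (r : Rep ↥(maximalRealSubfield (F : Type)) (imagUnitSq F))
      (ε : Eps ↥(maximalRealSubfield (F : Type)) (imagUnitSq F))
      (_hadm : ∃ e : (F : Type), IsAdmissibleElement (F : Type) hμ.cmType.1 e ∧
        epsOf ↥(maximalRealSubfield (F : Type)) (imagUnitSq F) (F : Type) (2 * imagUnit (F : Type))⁻¹ (-e) = ε)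
      (χ : Chi ↥(maximalRealSubfield (F : Type)) (F : Type) (IsCMField.complexConj (F : Type)))
      (H : Type) [AddCommGroup H] [Module ℂ H] (rhoB : Representation ℂ (sec42DataGS S h4 isoₛ).G H)
      (B : (sec42DataGS S h4 isoₛ).BettiPinning (sec42HeckeTranslatesGS S hU7ₛ h4 isoₛ) ι₁ H rhoB)
      (K : C5.SmallLevel K₀) (y : (sec42DataGS S h4 isoₛ).bettiH1 ι₁ K),
      B.b K y ∈ ⨆ ψ : Representation.IntertwiningMap (G := (sec42DataGS S h4 isoₛ).G)
          ((rhoVAtLine ↥(maximalRealSubfield (F : Type)) (F : Type) (IsCMField.complexConj (F : Type)) 2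
            (finProdFinEquiv : Fin 2 × Fin 1 ≃ Fin (2 * 1)) (Matrix.diagonal dJ)
            (complexConj_imagUnit F) (imagUnit_ne_zero F) (imagUnit_mul_self F) (realDiagonal_isSymm F dJ hdJ)
            (isUnit_det_realDiagonal F dJ hdJ hdJ0) (realDiagonal_map F dJ hdJ).symm
            (hsChiGS F finProdFinEquiv dJ hdJ hdJ0
              (toHeckeCharacter (F : Type) (galConj (IsCMField.complexConj (F : Type)) μ))
              (isUnitary_toHeckeCharacter (F : Type) (galConj (IsCMField.complexConj (F : Type)) μ))
              ((isOscillatorChar_toHeckeCharacter_iff (galConj (IsCMField.complexConj (F : Type)) μ)).mpr hμ.galConj))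
            (r.toFun ε) χ).comp
            (finAdelicCongr ↥(maximalRealSubfield (F : Type)) (F : Type) (IsCMField.complexConj (F : Type)) gstar ht hg).symm.toMonoidHom)
          rhoB, LinearMap.range ψ.toLinearMap →
      letI : Algebra (F : Type) ℂ := algebraAlong (F : Type) ι₁
      (ι₁ ∈ hμ.cmType.1 →
        Literature.AlgebraicGeometry.HodgeTheory.IsOfHodgeType ((sec42DataGS S h4 isoₛ).A K).dim
          (((sec42DataGS S h4 isoₛ).A K).baseChange ℂ).X 1 1 0 y) ∧
      (ι₁ ∉ hμ.cmType.1 →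
        Literature.AlgebraicGeometry.HodgeTheory.IsOfHodgeType ((sec42DataGS S h4 isoₛ).A K).dim
          (((sec42DataGS S h4 isoₛ).A K).baseChange ℂ).X 1 0 1 y) := by
  intro F _ ι₁ μ hμ hw Jstar t ht hτt hτt' gstar dJ hdJ hdJ0 hg hsig K₀ S hU7ₛ h4 isoₛ r ε hadm χ H _ _ rhoB B K y hy
  obtain ⟨𝔣⟩ := UnitaryCurveForms.nonempty_coneFrame_of_sig (F : Type) ι₁ Jstar t hτt hτt' gstar dJ hg hsig.1
  -- the realisation with the type split: ★ typed closer (p798983) at the (A1) KERNEL ★ p799176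
  obtain ⟨rr, hinj, -, heqv, hsplit⟩ :=
    F0AlbCmS1RealisationHodge.stub_S1_realisationHodge_of_A1
      Literature.AlgebraicGeometry.HodgeTheory.ConjEmbedding.isOfHodgeType_conj_iff_holds F ι₁ Jstar K₀ S hU7ₛ h4 isoₛ H rhoB B 𝔣
  -- the signed exclusion: ★ p796247 at the letters E3hol ∕ E3antihol ∕ TPhol, with TPantihol DERIVED by conjugation (★ p797687)
  obtain ⟨hXhol, hXanti⟩ :=
    F0AlbCmS1bSignedExclusionNec.stub_S1b_signedExclusion_of_nec_letters hE3hol hE3antihol hTPhol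
      (Literature.NumberTheory.Automorphic.UnitaryCurveForms.antiholCotFormSpectralProjection₂_of_hol hTPhol)
      F ι₁ μ hμ hw Jstar t ht hτt hτt' gstar dJ hdJ hdJ0 hg hsig h4 r ε hadm χ 𝔣
  letI : Algebra (F : Type) ℂ := algebraAlong (F : Type) ι₁
  -- the place bit and the CM-type dichotomy
  have hbit : (cmPlace (F : Type) ι₁).1.embedding = ι₁ ∨
      (cmPlace (F : Type) ι₁).1.embedding = NumberField.ComplexEmbedding.conjugate ι₁ := embedding_mk_eq ι₁
  have hcm : ι₁ ∈ hμ.cmType.1 ↔ NumberField.ComplexEmbedding.conjugate ι₁ ∉ hμ.cmType.1 := hμ.cmType.2 ι₁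
  have hne : NumberField.ComplexEmbedding.conjugate ι₁ ≠ ι₁ := fun h =>
    (NumberField.InfinitePlace.isComplex_mk_iff.1 (isComplex_mk_of_isCMField (F : Type) ι₁))
      (NumberField.ComplexEmbedding.isReal_iff.2 h)
  -- «no ψ» in the plain-linear-map currency of the isotypic split lemma
  have noψ : ∀ (Ω : Submodule ℂ ((adelicGroupData ↥(maximalRealSubfield (F : Type)) (F : Type) (IsCMField.complexConj (F : Type)) 2 Jstar).Adelic → ℂ)),
      (∀ ψ : Representation.IntertwiningMap
        ((rhoVAtLine ↥(maximalRealSubfield (F : Type)) (F : Type) (IsCMField.complexConj (F : Type)) 2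
          (finProdFinEquiv : Fin 2 × Fin 1 ≃ Fin (2 * 1)) (Matrix.diagonal dJ)
          (complexConj_imagUnit F) (imagUnit_ne_zero F) (imagUnit_mul_self F) (realDiagonal_isSymm F dJ hdJ)
          (isUnit_det_realDiagonal F dJ hdJ hdJ0) (realDiagonal_map F dJ hdJ).symm
          (hsChiGS F finProdFinEquiv dJ hdJ hdJ0
            (toHeckeCharacter (F : Type) (galConj (IsCMField.complexConj (F : Type)) μ))
            (isUnitary_toHeckeCharacter (F : Type) (galConj (IsCMField.complexConj (F : Type)) μ))
            ((isOscillatorChar_toHeckeCharacter_iff (galConj (IsCMField.complexConj (F : Type)) μ)).mpr hμ.galConj))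
          (r.toFun ε) χ).comp
          (finAdelicCongr ↥(maximalRealSubfield (F : Type)) (F : Type) (IsCMField.complexConj (F : Type)) gstar ht hg).symm.toMonoidHom)
        (rightRep₂ ↥(maximalRealSubfield (F : Type)) (F : Type) (IsCMField.complexConj (F : Type)) Jstar),
        (∀ w, ψ w ∈ Ω) → ψ = 0) →
      ∀ ψ : _ →ₗ[ℂ] _, (∀ g w, ψ ((((rhoVAtLine ↥(maximalRealSubfield (F : Type)) (F : Type) (IsCMField.complexConj (F : Type)) 2
          (finProdFinEquiv : Fin 2 × Fin 1 ≃ Fin (2 * 1)) (Matrix.diagonal dJ)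
          (complexConj_imagUnit F) (imagUnit_ne_zero F) (imagUnit_mul_self F) (realDiagonal_isSymm F dJ hdJ)
          (isUnit_det_realDiagonal F dJ hdJ hdJ0) (realDiagonal_map F dJ hdJ).symm
          (hsChiGS F finProdFinEquiv dJ hdJ hdJ0
            (toHeckeCharacter (F : Type) (galConj (IsCMField.complexConj (F : Type)) μ))
            (isUnitary_toHeckeCharacter (F : Type) (galConj (IsCMField.complexConj (F : Type)) μ))
            ((isOscillatorChar_toHeckeCharacter_iff (galConj (IsCMField.complexConj (F : Type)) μ)).mpr hμ.galConj))
          (r.toFun ε) χ).comp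
          (finAdelicCongr ↥(maximalRealSubfield (F : Type)) (F : Type) (IsCMField.complexConj (F : Type)) gstar ht hg).symm.toMonoidHom)) g w) =
          (rightRep₂ ↥(maximalRealSubfield (F : Type)) (F : Type) (IsCMField.complexConj (F : Type)) Jstar) g (ψ w)) → (∀ w, ψ w ∈ Ω) → ψ = 0 := by
    intro Ω hno ψ hψG hψΩ
    have h := hno (ψ.intertwiningMap_of_isIntertwiningMap _ _ hψG) hψΩ
    have h0 : (ψ.intertwiningMap_of_isIntertwiningMap _ _ hψG).toLinearMap = ψ := rfl
    rw [← h0, h, Representation.IntertwiningMap.zero_toLinearMap]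
  -- the isotypic split lemma, both orientations
  have key := fun (Ωhol Ωanti : Submodule ℂ ((adelicGroupData ↥(maximalRealSubfield (F : Type)) (F : Type) (IsCMField.complexConj (F : Type)) 2 Jstar).Adelic → ℂ)) =>
    B.isOfHodgeType_of_mem_isotypic _ (rightRep₂ ↥(maximalRealSubfield (F : Type)) (F : Type) (IsCMField.complexConj (F : Type)) Jstar) Ωhol Ωanti rr hinj heqv K y hy
  rcases hbit with hb | hb
  · -- `e♮ = ι₁`: REVERSED split — `(1,0) ↦ conj hol =: Ωanti`, `(0,1) ↦ hol =: Ωhol`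
    have hs := fun (L : C5.SmallLevel K₀) (z : (sec42DataGS S h4 isoₛ).bettiH1 ι₁ L) => (hsplit L z).1 hb
    have k := key _ _ (fun L z => ⟨(hs L z).1, (hs L z).2⟩)
    refine ⟨fun hι => k.1 (noψ _ (hXhol (by rw [hb]; exact hι))), fun hι => k.2 (noψ _ (hXanti (by rw [hb]; exact hι)))⟩
  · -- `e♮ = ῑ₁`: STRAIGHT split — `(1,0) ↦ hol =: Ωanti`, `(0,1) ↦ conj hol =: Ωhol`
    have hb' : (cmPlace (F : Type) ι₁).1.embedding ≠ ι₁ := by rw [hb]; exact hne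
    have hs := fun (L : C5.SmallLevel K₀) (z : (sec42DataGS S h4 isoₛ).bettiH1 ι₁ L) => (hsplit L z).2 hb'
    have k := key _ _ (fun L z => ⟨(hs L z).1, (hs L z).2⟩)
    refine ⟨fun hι => k.1 (noψ _ (hXanti ?_)), fun hι => k.2 (noψ _ (hXhol ?_))⟩
    · rw [hb]; exact hcm.1 hι
    · rw [hb]; by_contra hc; exact hι (hcm.2 hc)

/-- **`stub_S1b_hodge_holds_nec_of_hol` — the parent's `stub_S1b_hodge : S1bHodgeShape` MODULO E3nec-hol AND TPhol ONLY** (the antihol necessity supplied by ★ T1′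
`E3Necessity.curveThetaHodgeTypeNecessity_antihol_of_hol`).  Conclusion token-identical to `stub_S1b_hodge_holds_nec`. [cite: Liu2021, App. D Rem. D.5 (p. 131); proof of Thm. D.6 (1) (p. 140)] -/
theorem stub_S1b_hodge_holds_nec_of_hol
    (hE3hol : Literature.NumberTheory.Rogawski1990.curveThetaHodgeTypeNecessity_hol)
    (hTPhol : Literature.NumberTheory.Automorphic.UnitaryCurveForms.holCotFormSpectralProjection₂) :
    ∀ (F : CMField) [IsGalois ℚ F] (ι₁ : F →+* ℂ)
      (μ : Literature.NumberTheory.Automorphic.IdeleClassGroup (F : Type) →ₜ* Circle)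
      (hμ : IdeleClassGroup.IsConjugateSymplectic (F : Type) μ)
      (_hw : IdeleClassGroup.HasWeight (F : Type) μ 1)
      (Jstar : Matrix (Fin 2) (Fin 2) (F : Type)) (t : (F : Type)) (ht : t ≠ 0) (_hτt : 0 < (ι₁ t).re) (_hτt' : (ι₁ t).im = 0)
      (gstar : GL (Fin 2) (F : Type))
      (dJ : Fin 2 → (F : Type)) (hdJ : ∀ i, IsCMField.complexConj (F : Type) (dJ i) = dJ i) (hdJ0 : ∀ i, dJ i ≠ 0)
      (hg : formCongr ((IsCMField.complexConj (F : Type) : (F : Type) ≃ₐ[↥(maximalRealSubfield (F : Type))] (F : Type)) :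
          (F : Type) →+* (F : Type)) gstar (t • Jstar) = Matrix.diagonal dJ)
      (_hsig : (∃ Tstar : GL (Fin 2) ℂ,
          formCongr (starRingEnd ℂ) Tstar ((Matrix.diagonal dJ).map ι₁) = Matrix.diagonal ![(1 : ℂ), -1]) ∧
        ∀ τ' : (F : Type) →+* ℂ, InfinitePlace.mk τ' ≠ InfinitePlace.mk ι₁ → ((Matrix.diagonal dJ).map τ').PosDef)
      (K₀ : C5.OpenCompactSubgroup ↥(finAdelic ↥(maximalRealSubfield (F : Type)) (F : Type) (IsCMField.complexConj (F : Type)) 2 Jstar))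
      (S : RecordSystemGS (F : Type) Jstar ι₁ K₀) (hU7ₛ : S.HeckeTranslateDefinedOver)
      (h4 : 4 ≤ Module.finrank ℚ (F : Type)) (isoₛ : ℕ → Prop)
      (r : Rep ↥(maximalRealSubfield (F : Type)) (imagUnitSq F))
      (ε : Eps ↥(maximalRealSubfield (F : Type)) (imagUnitSq F))
      (_hadm : ∃ e : (F : Type), IsAdmissibleElement (F : Type) hμ.cmType.1 e ∧
        epsOf ↥(maximalRealSubfield (F : Type)) (imagUnitSq F) (F : Type) (2 * imagUnit (F : Type))⁻¹ (-e) = ε)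
      (χ : Chi ↥(maximalRealSubfield (F : Type)) (F : Type) (IsCMField.complexConj (F : Type)))
      (H : Type) [AddCommGroup H] [Module ℂ H] (rhoB : Representation ℂ (sec42DataGS S h4 isoₛ).G H)
      (B : (sec42DataGS S h4 isoₛ).BettiPinning (sec42HeckeTranslatesGS S hU7ₛ h4 isoₛ) ι₁ H rhoB)
      (K : C5.SmallLevel K₀) (y : (sec42DataGS S h4 isoₛ).bettiH1 ι₁ K),
      B.b K y ∈ ⨆ ψ : Representation.IntertwiningMap (G := (sec42DataGS S h4 isoₛ).G)
          ((rhoVAtLine ↥(maximalRealSubfield (F : Type)) (F : Type) (IsCMField.complexConj (F : Type)) 2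
            (finProdFinEquiv : Fin 2 × Fin 1 ≃ Fin (2 * 1)) (Matrix.diagonal dJ)
            (complexConj_imagUnit F) (imagUnit_ne_zero F) (imagUnit_mul_self F) (realDiagonal_isSymm F dJ hdJ)
            (isUnit_det_realDiagonal F dJ hdJ hdJ0) (realDiagonal_map F dJ hdJ).symm
            (hsChiGS F finProdFinEquiv dJ hdJ hdJ0
              (toHeckeCharacter (F : Type) (galConj (IsCMField.complexConj (F : Type)) μ))
              (isUnitary_toHeckeCharacter (F : Type) (galConj (IsCMField.complexConj (F : Type)) μ))
              ((isOscillatorChar_toHeckeCharacter_iff (galConj (IsCMField.complexConj (F : Type)) μ)).mpr hμ.galConj))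
            (r.toFun ε) χ).comp
            (finAdelicCongr ↥(maximalRealSubfield (F : Type)) (F : Type) (IsCMField.complexConj (F : Type)) gstar ht hg).symm.toMonoidHom)
          rhoB, LinearMap.range ψ.toLinearMap →
      letI : Algebra (F : Type) ℂ := algebraAlong (F : Type) ι₁
      (ι₁ ∈ hμ.cmType.1 →
        Literature.AlgebraicGeometry.HodgeTheory.IsOfHodgeType ((sec42DataGS S h4 isoₛ).A K).dim
          (((sec42DataGS S h4 isoₛ).A K).baseChange ℂ).X 1 1 0 y) ∧
      (ι₁ ∉ hμ.cmType.1 →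
        Literature.AlgebraicGeometry.HodgeTheory.IsOfHodgeType ((sec42DataGS S h4 isoₛ).A K).dim
          (((sec42DataGS S h4 isoₛ).A K).baseChange ℂ).X 1 0 1 y) :=
  stub_S1b_hodge_holds_nec hE3hol (E3Necessity.curveThetaHodgeTypeNecessity_antihol_of_hol hE3hol) hTPhol

end Summit.HodgeConjecture.HodgeConjecture.Cruxes.HLiu418.F0AlbCmS1bHodgeHoldsNec

end
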